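/-
Copyright (c) 2026 the pub-hodgecm-mathlib formalisation cell (harness21).  Prover seat hodgecm-mathlib-F0P3a-p04 (g30), carve (c8) of SIG-F3-5 v1 (pen LH7-p04 (g12),
00:24:06Z target `hgate`), heir LEAD F0P3a-plan (g16) T14-66 ∕ T15-08, 2026-09-03.
-/
import Literature.NumberTheory.Automorphic.TypeTwoGateAtOverOrderGeneratorUniform   -- ★ C8-odd p853170 (this seat): `algHom_prod_apply_eq_blockFrame`, `quad_of_coord`; brings ★ L8, ★ (c5-i)
import Literature.NumberTheory.Automorphic.TypeTwoSelfDualCyclicParityWildUnit        -- ★ p852848 (this seat): the W-UNIT gate `exists_selfDual_cyclic_iff_even_log_wildUnit`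
import HarnessLib

/-!
# The F4 gate at a unitary generator of a glued over-order — W-UNIT row (carve (c8), corollary C8-unit)

Topic `NumberTheory/Automorphic`; namespace `Literature.NumberTheory.Automorphic.SymmetricEigenframe`.  ONE THEOREM (no definition, no instance, no notation, no named fact, no
`sorry`); count-neutral; kernel lane `--supports stmt-HodgeConjecture-24833`.  Cell `pub/hodgecm-mathlib` (D-0151), crux H413; road M6, route (B), F3-5b's binder `hgate` (pen
LH7-p04 (g12)), ROW W (wild UNIT discriminant: `K = E(α)`, `α² = 1 + w_K`, `|w_K| < 1`, `ια = −α`).  SIBLING of ★ C8-odd p853170 `gate_at_generator_uniform` with the ★ W-UNIT gate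
p852848 `exists_selfDual_cyclic_iff_even_log_wildUnit` in place of the uniform one: the gate's `τ`-free package is the W-unit one (`hια hα hw hfix`, no `h20`, no `θ`-coordinates, NO
conductor exponent), the generator is `x′ = (u′, p′ + q′Θ)` with `Θ` ROW W's Eisenstein generator (`|Θ| < 1`, `ιΘ ≠ Θ` — binders), everything else as C8-odd: `hχ′`∕`hx₀′` by §1 of
C8-odd + ★ (c5-i), `hτU′` by `hstar`, eigen-data by ★ (c8)-L8 p853038 (`hexpn′` at `n := b`).  Conclusion: `(∃ w, ∃ g₁ ∈ U(σ,J), span (range fun k => (φ′ x′ ^ k) *ᵥ w) = span (range g₁ᵀ))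
↔ Even (log|ᵗσ(x₀)Jx₀| + b)`.  [cite: Rogawski1990, §4.9 Lemma 4.9.3 p. 56, Prop. 4.9.1 (b) p. 55] [cite: Jacobowitz1962, §7 Thm. 7.1, §§9–11] [cite: SerreLocalFields1979, Ch. V §2 Prop. 3]
HONEST LABEL: count-neutral; zero label movement until F5 ★ + a desk-priced rider; HC_CM is proved only modulo the 7 printed citations (2 remaining named inputs: hLiu418 =
stmt-HodgeConjecture-24832, h413 = stmt-HodgeConjecture-24833) until rung 0 closes.

## References
* [Rogawski1990] J. D. Rogawski, *Automorphic Representations of Unitary Groups in Three Variables*, Ann. of Math. Stud. 123 (1990): §4.9 Lemma 4.9.3 p. 56, Prop. 4.9.1 (b) p. 55.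
* [Jacobowitz1962] R. Jacobowitz, *Hermitian forms over local fields*, Amer. J. Math. 84 (1962): §7 Thm. 7.1, §§9–11 (dyadic).
* [SerreLocalFields1979] J.-P. Serre, *Local Fields*, GTM 67 (1979): Ch. V §2 Prop. 3 (norms of units, unramified).
-/

set_option autoImplicit false

noncomputable section

open Polynomial Matrix
open scoped MatrixGroups ValuativeRel WithZero

namespace Literature.NumberTheory.Automorphic.SymmetricEigenframe

open Literature.NumberTheory.Rogawski1990 Literature.NumberTheory.Automorphic Literature.NumberTheory.Automorphic.UnitaryGroup

/-- **C8-unit — THE F4 GATE AT A UNITARY GENERATOR OF A GLUED OVER-ORDER, W-UNIT ROW.**  As C8-odd `gate_at_generator_uniform`, over the ★ W-unit gate p852848: frame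
`α² = 1 + w_K`, `ια = −α`, `Fix ι = E`; generator `x′ = (u′, p′ + q′Θ)` with `|Θ| < 1`, `ιΘ ≠ Θ`; no conductor exponent.  A self-dual `φ′ x′`-cyclic lattice exists iff `ord⟨x₀,x₀⟩_J + b`
is even. [cite: Rogawski1990, §4.9 Lemma 4.9.3 p. 56, Prop. 4.9.1 (b) p. 55] [cite: Jacobowitz1962, §7 Thm. 7.1, §§9–11] [cite: SerreLocalFields1979, Ch. V §2 Prop. 3] -/
theorem gate_at_generator_wildUnit
    {E K : Type*} [Field E] [Valued E ℤᵐ⁰] [ValuativeRel E] [(Valued.v : Valuation E ℤᵐ⁰).Compatible]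
    [Field K] [Valued K ℤᵐ⁰] [ValuativeRel K] [(Valued.v : Valuation K ℤᵐ⁰).Compatible] [Algebra E K]
    -- the gate's `τ`-free package (★ `exists_selfDual_cyclic_iff_even_log_wildUnit`'s letters, `j := algebraMap E K`)
    (σ : E →+* E) (hσσ : ∀ x, σ (σ x) = x) (hσO : ∀ x : 𝒪[E], σ x ∈ 𝒪[E])
    (hnorm : ∀ u : 𝒪[E], IsUnit u → σ u = u → ∃ t : 𝒪[E], (t : E) * σ t = u)
    {ω : E} (hω : Valued.v ω ≤ 1) (hωtr : Valued.v (ω + σ ω) = 1)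
    (J : GL (Fin 3) E) (hJ : J ∈ glInt 3 E) (hJh : ((J : Matrix (Fin 3) (Fin 3) E).map σ)ᵀ = J)
    (hjv : ∀ x, Valued.v (algebraMap E K x) = Valued.v x ^ 2)
    (σK ι : K →+* K) (hσj : ∀ x, σK (algebraMap E K x) = algebraMap E K (σ x)) (hσKσK : ∀ y, σK (σK y) = y)
    (hσKv : ∀ y, Valued.v (σK y) = Valued.v y)
    (hιj : ∀ x, ι (algebraMap E K x) = algebraMap E K x) (hιι : ∀ y, ι (ι y) = y) (hιv : ∀ y, Valued.v (ι y) = Valued.v y)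
    (hσKι : ∀ y, σK (ι y) = ι (σK y))
    {α wK : K} (hια : ι α = -α) (hα : α * α = 1 + wK) (hw : Valued.v wK < 1)
    (hfix : ∀ y : K, ι y = y → ∃ x : E, algebraMap E K x = y)
    (hrE : ∀ x : K, x ≠ 0 → ι x = x → Even (WithZero.log (Valued.v x)))
    (hnK : ∀ c : K, c ≠ 0 → σK c = c → Even (WithZero.log (Valued.v c)) → ∃ a : K, a * σK a * c = 1)
    (hnE : ∀ c : K, c ≠ 0 → σK c = c → ι c = c → (4 : ℤ) ∣ WithZero.log (Valued.v c) → ∃ a : K, ι a = a ∧ a * σK a * c = 1)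
    -- the Eisenstein generator `Θ` of ROW W's package (a non-unit, not `ι`-fixed)
    {θ : K} (hθ1 : Valued.v θ < 1) (hιθne : ι θ ≠ θ)
    -- the block ∕ endoscopic frame of `τ = φ (g, u)` (★ (O-5) p852929, ★ (c5-i) p853057, ★ (c5-ii-B) p853134)
    (cfr : GL (Fin 3) E) (φ : (Matrix (Fin 2) (Fin 2) E × E) →ₐ[E] Matrix (Fin 3) (Fin 3) E)
    (hφ : ∀ (g : Matrix (Fin 2) (Fin 2) E) (u : E),
      φ (g, u) = (cfr : Matrix (Fin 3) (Fin 3) E) * Matrix.reindex endoPerm endoPerm (Matrix.fromBlocks g 0 0 (u • (1 : Matrix (Fin 1) (Fin 1) E))) *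
        ((cfr⁻¹ : GL (Fin 3) E) : Matrix (Fin 3) (Fin 3) E))
    (g : Matrix (Fin 2) (Fin 2) E) (u : E) (hirr : ∀ x : E, x * x - g.trace * x + g.det ≠ 0) {lam : K}
    (hlam : lam ^ 2 - algebraMap E K g.trace * lam + algebraMap E K g.det = 0)
    (φ' : (E × K) →ₐ[E] Matrix (Fin 3) (Fin 3) E) (hφ'x : φ' ((u, lam) : E × K) = φ (g, u))
    (hall : ∀ b : E × K, ∃ P : E[X], aeval ((u, lam) : E × K) P = b)
    (hstar : ∀ b : E × K, (J : Matrix (Fin 3) (Fin 3) E) * φ' (RingHom.prodMap σ σK b) = ((φ' b).map σ)ᵀ * (J : Matrix (Fin 3) (Fin 3) E))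
    (hcoordlam : ∀ z : K, ∃ p q : E, z = algebraMap E K p + algebraMap E K q * lam)
    -- the generator `x′ = (u′, p′ + q′θ)` with ★ (UG)'s data (i)–(iii)
    {u' p' q' t' D' : E} {N'' b : ℕ}
    (hunit : ((u', algebraMap E K p' + algebraMap E K q' * θ) : E × K) *
      RingHom.prodMap σ σK ((u', algebraMap E K p' + algebraMap E K q' * θ) : E × K) = 1)
    (hu1 : Valued.v (u' - 1) < 1) (hp1 : Valued.v (p' - 1) < 1) (hq : Valued.v q' = WithZero.exp (-(N'' : ℤ)))
    (hquad' : (algebraMap E K p' + algebraMap E K q' * θ) ^ 2 - algebraMap E K t' * (algebraMap E K p' + algebraMap E K q' * θ) +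
      algebraMap E K D' = 0)
    (hb : Valued.v (u' * u' - t' * u' + D') = WithZero.exp (-(b : ℤ))) :
    (∃ w : Fin 3 → E, ∃ g₁ ∈ unitaryGroupOfForm σ (J : Matrix (Fin 3) (Fin 3) E),
      Submodule.span 𝒪[E] (Set.range fun k : Fin 3 =>
        ((φ' ((u', algebraMap E K p' + algebraMap E K q' * θ) : E × K)) ^ (k : ℕ)) *ᵥ w) =
        Submodule.span 𝒪[E] (Set.range ((g₁ : Matrix (Fin 3) (Fin 3) E))ᵀ)) ↔
    Even (WithZero.log (Valued.v (∑ k, ∑ i, σ (((cfr : Matrix (Fin 3) (Fin 3) E) *ᵥ Pi.single (endoPerm (Sum.inr 0)) (1 : E)) i) *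
      (J : Matrix (Fin 3) (Fin 3) E) i k * ((cfr : Matrix (Fin 3) (Fin 3) E) *ᵥ Pi.single (endoPerm (Sum.inr 0)) (1 : E)) k)) + b) := by
  -- the generator, its eigenline, its `λ`-coordinates
  set lam' : K := algebraMap E K p' + algebraMap E K q' * θ with hlam'def
  obtain ⟨p, q, hpq⟩ := hcoordlam lam'
  have hφ'x' : φ' ((u', lam') : E × K) = φ (p • (1 : Matrix (Fin 2) (Fin 2) E) + q • g, u') := by
    rw [hpq]; exact algHom_prod_apply_eq_blockFrame φ g u hirr hlam φ' hφ'x hall u' p q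
  -- §1: characteristic polynomial and eigenline at `τ′`
  have hχ' : (φ' ((u', lam') : E × K)).charpoly =
      (X - C u') * (X ^ 2 - C (p • (1 : Matrix (Fin 2) (Fin 2) E) + q • g).trace * X + C (p • (1 : Matrix (Fin 2) (Fin 2) E) + q • g).det) := by
    rw [hφ'x', charpoly_blockFrame cfr φ hφ, Matrix.charpoly_fin_two, mul_comm]
  have hx₀' : φ' ((u', lam') : E × K) *ᵥ ((cfr : Matrix (Fin 3) (Fin 3) E) *ᵥ Pi.single (endoPerm (Sum.inr 0)) (1 : E)) =
      u' • ((cfr : Matrix (Fin 3) (Fin 3) E) *ᵥ Pi.single (endoPerm (Sum.inr 0)) (1 : E)) := by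
    rw [hφ'x']; exact blockFrame_mulVec_frameVector cfr φ hφ _ _
  have hx₀0 := frameVector_ne_zero cfr
  have hquad₁ : lam' ^ 2 - algebraMap E K (p • (1 : Matrix (Fin 2) (Fin 2) E) + q • g).trace * lam' +
      algebraMap E K (p • (1 : Matrix (Fin 2) (Fin 2) E) + q • g).det = 0 := by
    rw [hpq]; exact quad_of_coord g hlam p q
  -- unitarity: `σu′·u′ = 1`, `λ′·σλ′ = 1`, `(σ τ′)ᵀ J τ′ = J` (from `hstar`)
  have hσu' : σ u' * u' = 1 := by
    have h := congrArg Prod.fst hunit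
    change u' * σ u' = 1 at h
    rwa [mul_comm] at h
  have hσlam' : lam' * σK lam' = 1 := by
    have h := congrArg Prod.snd hunit
    change lam' * σK lam' = 1 at h
    exact h
  have hτU' : ((φ' ((u', lam') : E × K)).map σ)ᵀ * (J : Matrix (Fin 3) (Fin 3) E) * φ' ((u', lam') : E × K) = J := by
    rw [← hstar, Matrix.mul_assoc, ← map_mul,
      show RingHom.prodMap σ σK ((u', lam') : E × K) * (u', lam') = 1 by rw [mul_comm]; exact hunit, map_one, Matrix.mul_one]
  -- the eigen-data via ★ (c8)-L8
  have hq0 : q' ≠ 0 := fun h => by rw [h, map_zero] at hq; exact WithZero.exp_ne_zero hq.symm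
  have hq1 : Valued.v q' ≤ 1 := by rw [hq, ← WithZero.exp_zero]; exact WithZero.exp_le_exp.2 (by omega)
  have hp1' : Valued.v p' ≤ 1 := by
    have h := Valuation.map_one_add_of_lt (Valued.v : Valuation E ℤᵐ⁰) hp1
    rw [add_sub_cancel] at h
    exact h.le
  have hlamO' : lam' ∈ 𝒪[K] := (v_le_one_iff_mem_integer _).1 (v_generator_le_one (algebraMap E K) hjv hθ1.le hp1' hq1)
  have hlam1' := v_generator_sub_one_lt_one (algebraMap E K) hjv hθ1 hp1 hq1
  have hne' := iota_generator_ne (algebraMap E K) ι hιj hιθne hq0 (p' := p')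
  have hexpn' := v_j_sub_generator_eq_exp (algebraMap E K) hjv ι hιj hιv hquad' hne' hb
  exact exists_selfDual_cyclic_iff_even_log_wildUnit σ hσσ hσO hnorm hω hωtr J hJ hJh _ hτU' hχ' hσu' hu1 hx₀' hx₀0
    (algebraMap E K) hjv σK ι hσj hσKσK hσKv hιj hιι hιv hσKι hια hα hw hfix hquad₁ hlamO' hlam1' hσlam' hne' hexpn' hrE hnK hnE


end Literature.NumberTheory.Automorphic.SymmetricEigenframe

end
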